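import Mathlib.Analysis.LocallyConvex.Separation
import Mathlib.Analysis.Convex.Function
import Mathlib.LinearAlgebra.Pi
import Mathlib.Topology.Algebra.Module.FiniteDimension
import Mathlib.Algebra.Order.Field.Basic
import Literature.Analysis.Convex.LagrangianDuality
import HarnessLib

/-!
# Lagrangian duality with dual attainment under the Slater condition — proof

Discharge of the named fact `Literature.Analysis.Convex.BorweinLewis2000_dualAttainment`
(`LagrangianDuality.lean`; Borwein–Lewis 2000, Thm 4.3.7 "Dual attainment", real-valued data on a
convex domain `C`): if `f, g₁, …, g_m` are convex on `C`, a Slater point `x₀ ∈ C` has `gᵢ(x₀) < 0`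
for all `i`, and `p ≤ f(x)` for every feasible `x ∈ C`, then there are multipliers `λᵢ ≥ 0` with
`p ≤ f(x) + Σ λᵢ gᵢ(x)` for all `x ∈ C`.

Proof (the separation argument behind Borwein–Lewis §4.3 / §3.2, cf. the proof of Thm 3.2.8 and
Thm 4.3.7): in `ℝ^{1+m}` the convex set `A = {(r, s) : ∃ x ∈ C, f x ≤ r, gᵢ x ≤ sᵢ}` is disjoint
from the open convex set `B = {(r, s) : r < p, sᵢ < 0}`; a separating functional
`φ = (μ₀, μ₁, …, μ_m)` (`geometric_hahn_banach_open`) has `μ ≥ 0` because `φ` is bounded above on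
`B`, satisfies `μ₀ p ≤ u ≤ μ₀ f(x) + Σ μᵢ gᵢ(x)` on `C`, and `μ₀ > 0` by the Slater point; take
`λᵢ = μᵢ / μ₀`.

## References
* [BorweinLewis2000] J. M. Borwein, A. S. Lewis, *Convex Analysis and Nonlinear Optimization*,
  CMS Books in Mathematics, Springer (2000), Thm 4.3.7 (with Prop 3.2.8 / (3.2.7)).
-/

namespace Literature.Analysis.Convex

section BorweinLewis2000Proof

open Finset

/-- **Borwein–Lewis 2000, Thm 4.3.7 (dual attainment under the Slater condition) — proved**
(discharge of `BorweinLewis2000_dualAttainment`), by separating `{(r,s) : ∃ x ∈ C, f x ≤ r, g x ≤ s}`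
from `{(r,s) : r < p, s < 0}` in `ℝ^{1+m}` (Mathlib's `geometric_hahn_banach_open`).
[cite: BorweinLewis2000, Thm 4.3.7] -/
theorem BorweinLewis2000_dualAttainment_holds : BorweinLewis2000_dualAttainment := by
  intro E _ _ _ m C f g hf hg hS p hp
  classical
  obtain ⟨x₀, hx₀C, hx₀⟩ := hS
  -- the two convex subsets of `ℝ^{1+m}` (coordinate `0`: objective; coordinate `i.succ`: `gᵢ`)
  set A : Set (Fin (m + 1) → ℝ) :=
    {q | ∃ x ∈ C, f x ≤ q 0 ∧ ∀ i, g i x ≤ q i.succ} with hA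
  set B : Set (Fin (m + 1) → ℝ) := {q | q 0 < p} ∩ ⋂ i : Fin m, {q | q i.succ < 0} with hB
  have hAconv : Convex ℝ A := by
    intro q hq q' hq' a b ha hb hab
    obtain ⟨x, hxC, hfx, hgx⟩ := hq
    obtain ⟨x', hx'C, hfx', hgx'⟩ := hq'
    refine ⟨a • x + b • x', hf.1 hxC hx'C ha hb hab, ?_, fun i => ?_⟩
    · have h := hf.2 hxC hx'C ha hb hab
      simp only [smul_eq_mul, Pi.add_apply, Pi.smul_apply] at h ⊢
      nlinarith [mul_le_mul_of_nonneg_left hfx ha, mul_le_mul_of_nonneg_left hfx' hb]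
    · have h := (hg i).2 hxC hx'C ha hb hab
      simp only [smul_eq_mul, Pi.add_apply, Pi.smul_apply] at h ⊢
      nlinarith [mul_le_mul_of_nonneg_left (hgx i) ha, mul_le_mul_of_nonneg_left (hgx' i) hb]
  have hlin : ∀ j : Fin (m + 1), IsLinearMap ℝ (fun q : Fin (m + 1) → ℝ => q j) :=
    fun j => ⟨fun _ _ => rfl, fun _ _ => rfl⟩
  have hBconv : Convex ℝ B :=
    (convex_halfSpace_lt (hlin 0) p).inter
      (convex_iInter fun i : Fin m => convex_halfSpace_lt (hlin i.succ) 0)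
  have hBopen : IsOpen B :=
    (isOpen_lt (continuous_apply 0) continuous_const).inter
      (isOpen_iInter_of_finite fun i : Fin m => isOpen_lt (continuous_apply i.succ) continuous_const)
  have hmemB : ∀ q : Fin (m + 1) → ℝ, q ∈ B ↔ q 0 < p ∧ ∀ i : Fin m, q i.succ < 0 := by
    intro q
    simp [hB, Set.mem_iInter]
  have hdisj : Disjoint B A := by
    refine Set.disjoint_left.mpr fun q hqB hqA => ?_
    obtain ⟨hq0, hqi⟩ := (hmemB q).mp hqB
    obtain ⟨x, hxC, hfx, hgx⟩ := hqA
    have := hp x hxC fun i => ((hgx i).trans (hqi i).le)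
    linarith
  -- separate
  obtain ⟨φ, u, hφB, hφA⟩ := geometric_hahn_banach_open hBconv hBopen hAconv hdisj
  set μ : Fin (m + 1) → ℝ := fun j => φ (fun j' => if j = j' then 1 else 0) with hμ
  have hφ : ∀ q : Fin (m + 1) → ℝ, φ q = q 0 * μ 0 + ∑ i : Fin m, q i.succ * μ i.succ := by
    intro q
    have h := LinearMap.pi_apply_eq_sum_univ (φ : (Fin (m + 1) → ℝ) →ₗ[ℝ] ℝ) q
    simp only [ContinuousLinearMap.coe_coe, smul_eq_mul] at h
    rw [h, Fin.sum_univ_succ]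
  -- `φ` on `A`: the points `(f x, g x)`, `x ∈ C`
  have hAx : ∀ x ∈ C, u ≤ f x * μ 0 + ∑ i : Fin m, g i x * μ i.succ := by
    intro x hxC
    have hmem : (Fin.cons (f x) (fun i => g i x) : Fin (m + 1) → ℝ) ∈ A :=
      ⟨x, hxC, by simp, fun i => by simp⟩
    have h := hφA _ hmem
    rw [hφ] at h
    simpa using h
  -- `φ` on `B`: the points `(p - ε, v)`, `ε > 0`, `v < 0`
  have hBx : ∀ ε : ℝ, 0 < ε → ∀ v : Fin m → ℝ, (∀ i, v i < 0) →
      (p - ε) * μ 0 + ∑ i : Fin m, v i * μ i.succ < u := by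
    intro ε hε v hv
    have hmem : (Fin.cons (p - ε) v : Fin (m + 1) → ℝ) ∈ B := by
      rw [hmemB]
      exact ⟨by simp [hε], fun i => by simpa using hv i⟩
    have h := hφB _ hmem
    rw [hφ] at h
    simpa using h
  set Sμ : ℝ := ∑ i : Fin m, μ i.succ with hS
  -- (1) `v = -1`, `ε → ∞`: `μ 0 ≥ 0`
  have hB1 : ∀ ε : ℝ, 0 < ε → (p - ε) * μ 0 - Sμ < u := by
    intro ε hε
    have h := hBx ε hε (fun _ => -1) (fun _ => by norm_num)
    simp only [neg_one_mul, Finset.sum_neg_distrib] at h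
    rw [hS]
    linarith
  have hμ0 : 0 ≤ μ 0 := by
    by_contra hneg
    push Not at hneg
    -- `K = u - (p * μ 0 - Sμ)`; `hB1 ε : -ε * μ 0 < K`
    have key : ∀ ε : ℝ, 0 < ε → ε * (-μ 0) < u - (p * μ 0 - Sμ) := by
      intro ε hε; have := hB1 ε hε; linarith
    have hK : 0 < u - (p * μ 0 - Sμ) := by
      have := key 1 one_pos; nlinarith
    have hε : 0 < (u - (p * μ 0 - Sμ) + 1) / (-μ 0) := div_pos (by linarith) (by linarith)
    have := key _ hε
    rw [div_mul_cancel₀ _ (by linarith : (-μ 0) ≠ 0)] at this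
    linarith
  -- (2) `v = -1 - T eᵢ`, `T → ∞`: `μ i.succ ≥ 0`
  have hμi : ∀ i : Fin m, 0 ≤ μ i.succ := by
    intro i
    by_contra hneg
    push Not at hneg
    have key : ∀ T : ℝ, 0 < T → (p - 1) * μ 0 - Sμ + T * (-μ i.succ) < u := by
      intro T hT
      have h := hBx 1 one_pos (fun j => -1 - if j = i then T else 0) (fun j => by
        split_ifs <;> linarith)
      have hsum : ∑ j : Fin m, (-1 - if j = i then T else 0) * μ j.succ
          = -Sμ + T * (-μ i.succ) := by
        have : ∀ j : Fin m, (-1 - if j = i then T else 0) * μ j.succ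
            = -μ j.succ + (if j = i then -(T * μ j.succ) else 0) := by
          intro j; split_ifs <;> ring
        rw [Finset.sum_congr rfl fun j _ => this j, Finset.sum_add_distrib, Finset.sum_neg_distrib,
          Finset.sum_ite_eq' Finset.univ i, if_pos (Finset.mem_univ i), hS]
        ring
      rw [hsum] at h
      linarith
    have hK : 0 < u - ((p - 1) * μ 0 - Sμ) := by
      have := key 1 one_pos; nlinarith
    have hT : 0 < (u - ((p - 1) * μ 0 - Sμ) + 1) / (-μ i.succ) :=
      div_pos (by linarith) (by linarith)
    have := key _ hT
    rw [div_mul_cancel₀ _ (by linarith : (-μ i.succ) ≠ 0)] at this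
    linarith
  have hSμ : 0 ≤ Sμ := by rw [hS]; exact Finset.sum_nonneg fun i _ => hμi i
  -- (3) `v = -ε·1`, `ε → 0`: `p * μ 0 ≤ u`
  have hpu : p * μ 0 ≤ u := by
    refine le_of_forall_pos_lt_add fun δ hδ => ?_
    have hε : 0 < δ / (μ 0 + Sμ + 1) := div_pos hδ (by linarith)
    have h := hBx _ hε (fun _ => -(δ / (μ 0 + Sμ + 1))) (fun _ => by linarith)
    simp only [neg_mul, Finset.sum_neg_distrib, ← Finset.mul_sum] at h
    rw [← hS] at h
    -- `h : (p - ε) * μ 0 - ε * Sμ < u`, and `ε * (μ 0 + Sμ) < δ`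
    have hlt : δ / (μ 0 + Sμ + 1) * (μ 0 + Sμ) < δ := by
      rw [div_mul_eq_mul_div, div_lt_iff₀ (by linarith)]
      nlinarith
    nlinarith
  -- (4) the Slater point forces `μ 0 > 0`
  have hμ0pos : 0 < μ 0 := by
    rcases hμ0.eq_or_lt with h0 | h0
    · exfalso
      have hx := hAx x₀ hx₀C
      rw [← h0] at hx hpu hB1
      simp only [mul_zero, zero_add, zero_sub] at hx hpu hB1
      -- every term `g i x₀ * μ i.succ ≤ 0`, their sum is `≥ u ≥ 0`: all `μ i.succ = 0`
      have hterm : ∀ i ∈ (Finset.univ : Finset (Fin m)), g i x₀ * μ i.succ ≤ 0 :=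
        fun i _ => mul_nonpos_of_nonpos_of_nonneg (hx₀ i).le (hμi i)
      have hsum0 : ∑ i : Fin m, g i x₀ * μ i.succ = 0 :=
        le_antisymm (Finset.sum_nonpos hterm) (hpu.trans hx)
      have hzero : ∀ i : Fin m, μ i.succ = 0 := by
        intro i
        have h := (Finset.sum_eq_zero_iff_of_nonpos hterm).mp hsum0 i (Finset.mem_univ i)
        rcases mul_eq_zero.mp h with h | h
        · exact absurd h (hx₀ i).ne
        · exact h
      have hS0 : Sμ = 0 := by rw [hS]; exact Finset.sum_eq_zero fun i _ => hzero i
      have h1 := hB1 1 one_pos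
      rw [hS0, neg_zero] at h1
      rw [hsum0] at hx
      linarith
    · exact h0
  -- (5) the multipliers
  refine ⟨fun i => μ i.succ / μ 0, fun i => div_nonneg (hμi i) hμ0, fun x hxC => ?_⟩
  have hx := hAx x hxC
  have key : p * μ 0 ≤ (f x + ∑ i : Fin m, μ i.succ / μ 0 * g i x) * μ 0 := by
    have e : (f x + ∑ i : Fin m, μ i.succ / μ 0 * g i x) * μ 0
        = f x * μ 0 + ∑ i : Fin m, g i x * μ i.succ := by
      rw [add_mul, Finset.sum_mul]
      congr 1
      refine Finset.sum_congr rfl fun i _ => ?_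
      field_simp
    rw [e]
    exact hpu.trans hx
  exact le_of_mul_le_mul_right key hμ0pos

end BorweinLewis2000Proof

end Literature.Analysis.Convex
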